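import Mathlib
import Summits.AtomisticToContinuum.FouriersLaw.Theorems.EmbeddedDrudeMourreDrudeDissolutionFloorAlgebra
import HarnessLib

/-!
# Local Morse–Bott floors for a product `Ω = −A·S₁·S₂`: the neighbourhood statements
(crux `EmbeddedDrudeMourre.DrudeDissolution`, item stmt-AtomisticToContinuum-12593; `--supports` file for the
registered sub-goal `floorLocal_triple` of stub B1b″ `stub_excursionSecondDifference` of line
`kinetic-polymer-gas-on-the-time-axis`; closes nothing; lead c13 (process B), 2026-08-17)

WHAT. For functions `A S₁ S₂ a₁ a₂ a₃ c₁ c₂` on a topological space, continuous at `p₀`, and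
`P₁ = −a₁S₁S₂ + A c₁ S₂`, `P₂ = −a₂S₁S₂ + A S₁ c₂`, `P₃ = −a₃S₁S₂ − A c₁ S₂ − A S₁ c₂`,
`μ = A²S₁² + A²S₂² + S₁²S₂²`, we prove `∃ c > 0, ∀ᶠ p in 𝓝 p₀, c·μ ≤ P₁² + P₂² (+ P₃²)`:
* `floorLocal_curve`: `A(p₀) = 0`, `S₂(p₀) ≠ 0`, `a₂(p₀) ≠ 0`, `c₁(p₀) ≠ 0` (a co-moving curve; the other
  curve is the same lemma with indices swapped);
* `floorLocal_diag`: `S₁(p₀) = S₂(p₀) = 0`, `A(p₀) ≠ 0`, `cᵢ(p₀) ≠ 0` (the diagonal);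
* `floorLocal_triple` (registered): `a₁+a₂+a₃ ≠ 0` and `cᵢ ≠ 0` at `p₀` (the triple points);
* `floorLocal_regular`: `P₁²+P₃²+P₂² > 0` at `p₀` and `μ ≤ M`.
Each transports the pointwise algebra of the companion file `…FloorAlgebra` along finitely many
`ContinuousAt` eventualities (`eventually_abs_sub_le`).

WHY (role). Item (C4) of the remaining concrete work for B1b″ (gradient floor `D ≥ c·μ` off the corner
balls, by compactness from these local statements).
-/

noncomputable section

open scoped Topology
open Filter

namespace Summit.AtomisticToContinuum.FouriersLaw.Theorems.DrudeDissolution.KineticPolymerGasOnTheTimeAxis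

/-- Continuity at `p₀`, quantitatively: `|f p − f p₀| ≤ ε` eventually. [folklore] -/
theorem eventually_abs_sub_le {V : Type*} [TopologicalSpace V] {f : V → ℝ} {p₀ : V} (hf : ContinuousAt f p₀)
    {ε : ℝ} (hε : 0 < ε) : ∀ᶠ p in 𝓝 p₀, |f p - f p₀| ≤ ε :=
  (Metric.tendsto_nhds.1 hf ε hε).mono fun p hp => by rw [Real.dist_eq] at hp; exact hp.le

/-- **Local floor near a co-moving curve.** [folklore] -/
theorem floorLocal_curve {V : Type*} [TopologicalSpace V] {A S₁ S₂ a₁ a₂ c₁ c₂ P₁ P₂ : V → ℝ} {p₀ : V}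
    (hA : ContinuousAt A p₀) (hS₂ : ContinuousAt S₂ p₀) (ha₁ : ContinuousAt a₁ p₀) (ha₂ : ContinuousAt a₂ p₀)
    (hc₁ : ContinuousAt c₁ p₀) (hc₂ : ContinuousAt c₂ p₀)
    (hP₁ : ∀ p, P₁ p = -(a₁ p * S₁ p * S₂ p) + A p * c₁ p * S₂ p)
    (hP₂ : ∀ p, P₂ p = -(a₂ p * S₁ p * S₂ p) + A p * S₁ p * c₂ p)
    (hb₁ : ∀ p, |S₁ p| ≤ 1) (hb₂ : ∀ p, |S₂ p| ≤ 1)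
    (h0A : A p₀ = 0) (hσ : S₂ p₀ ≠ 0) (hα : a₂ p₀ ≠ 0) (hκ : c₁ p₀ ≠ 0) :
    ∃ c : ℝ, 0 < c ∧ ∀ᶠ p in 𝓝 p₀,
      c * (A p ^ 2 * S₁ p ^ 2 + A p ^ 2 * S₂ p ^ 2 + S₁ p ^ 2 * S₂ p ^ 2) ≤ P₁ p ^ 2 + P₂ p ^ 2 := by
  set σ := S₂ p₀ with hσdef
  set α := a₂ p₀ with hαdef
  set κ := c₁ p₀ with hκdef
  set γ := |a₁ p₀| + 1 with hγdef
  set γ₂ := |c₂ p₀| + 1 with hγ₂def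
  have hγ : 1 ≤ γ := by have := abs_nonneg (a₁ p₀); linarith
  have hγ₂ : 1 ≤ γ₂ := by have := abs_nonneg (c₂ p₀); linarith
  have hα2 : 0 < α ^ 2 := by positivity
  have hγ0 : 0 < γ := by linarith
  set t := min 1 (α ^ 2 / (8 * γ ^ 2)) with htdef
  have ht0 : 0 < t := lt_min one_pos (by positivity)
  have ht1 : t ≤ 1 := min_le_left _ _
  have ht2 : 8 * γ ^ 2 * t ≤ α ^ 2 := by
    have h := min_le_right 1 (α ^ 2 / (8 * γ ^ 2))
    rw [← htdef, le_div_iff₀ (by positivity)] at h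
    linarith
  have hσp : 0 < |σ| := abs_pos.2 hσ
  have hαp : 0 < |α| := abs_pos.2 hα
  have hκp : 0 < |κ| := abs_pos.2 hκ
  have e1 := eventually_abs_sub_le hS₂ (half_pos hσp)
  have e2 := eventually_abs_sub_le ha₂ (show 0 < |α| / 4 by positivity)
  have e3 := eventually_abs_sub_le hc₁ (half_pos hκp)
  have e4 := eventually_abs_sub_le ha₁ one_pos
  have e5 := eventually_abs_sub_le hc₂ one_pos
  have e6 := eventually_abs_sub_le hA (show 0 < |α| * |σ| / (8 * γ₂) by positivity)
  refine ⟨σ ^ 2 * min (t * κ ^ 2) (α ^ 2) / 64, ?_, ?_⟩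
  · have : 0 < min (t * κ ^ 2) (α ^ 2) := lt_min (by positivity) hα2
    positivity
  filter_upwards [e1, e2, e3, e4, e5, e6] with p h1 h2 h3 h4 h5 h6
  rw [hP₁, hP₂]
  have h4' : |a₁ p| ≤ γ := by have := abs_sub_abs_le_abs_sub (a₁ p) (a₁ p₀); linarith
  have h5' : |c₂ p| ≤ γ₂ := by have := abs_sub_abs_le_abs_sub (c₂ p) (c₂ p₀); linarith
  have h6' : |A p| ≤ |α| * |σ| / (8 * γ₂) := by rwa [h0A, sub_zero] at h6
  exact floorAlg_curve hγ hγ₂ (hb₁ p) (hb₂ p) h1 h2 h3 h4' h5' h6' ht0 ht1 ht2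

/-- **Local floor near the diagonal (off the triple points).** [folklore] -/
theorem floorLocal_diag {V : Type*} [TopologicalSpace V] {A S₁ S₂ a₁ a₂ c₁ c₂ P₁ P₂ : V → ℝ} {p₀ : V}
    (hA : ContinuousAt A p₀) (hS₁ : ContinuousAt S₁ p₀) (hS₂ : ContinuousAt S₂ p₀) (ha₁ : ContinuousAt a₁ p₀)
    (ha₂ : ContinuousAt a₂ p₀) (hc₁ : ContinuousAt c₁ p₀) (hc₂ : ContinuousAt c₂ p₀)
    (hP₁ : ∀ p, P₁ p = -(a₁ p * S₁ p * S₂ p) + A p * c₁ p * S₂ p)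
    (hP₂ : ∀ p, P₂ p = -(a₂ p * S₁ p * S₂ p) + A p * S₁ p * c₂ p)
    (hb₂ : ∀ p, |S₂ p| ≤ 1) (h0S₁ : S₁ p₀ = 0) (h0S₂ : S₂ p₀ = 0) (hA0 : A p₀ ≠ 0)
    (hκ₁ : c₁ p₀ ≠ 0) (hκ₂ : c₂ p₀ ≠ 0) :
    ∃ c : ℝ, 0 < c ∧ ∀ᶠ p in 𝓝 p₀,
      c * (A p ^ 2 * S₁ p ^ 2 + A p ^ 2 * S₂ p ^ 2 + S₁ p ^ 2 * S₂ p ^ 2) ≤ P₁ p ^ 2 + P₂ p ^ 2 := by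
  set A₀ := A p₀ with hA₀def
  set κ₁ := c₁ p₀ with hκ₁def
  set κ₂ := c₂ p₀ with hκ₂def
  set γ := |a₁ p₀| + |a₂ p₀| + 1 with hγdef
  have hγ : 1 ≤ γ := by have := abs_nonneg (a₁ p₀); have := abs_nonneg (a₂ p₀); linarith
  have hγ0 : 0 < γ := by linarith
  have hAp : 0 < |A₀| := abs_pos.2 hA0
  have hκ₁p : 0 < |κ₁| := abs_pos.2 hκ₁
  have hκ₂p : 0 < |κ₂| := abs_pos.2 hκ₂
  have e1 := eventually_abs_sub_le hA (half_pos hAp)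
  have e2 := eventually_abs_sub_le hc₁ (half_pos hκ₁p)
  have e3 := eventually_abs_sub_le hc₂ (half_pos hκ₂p)
  have e4 := eventually_abs_sub_le ha₁ one_pos
  have e5 := eventually_abs_sub_le ha₂ one_pos
  have e6 := eventually_abs_sub_le hS₁ (show 0 < |A₀| * |κ₁| / (8 * γ) by positivity)
  have e7 := eventually_abs_sub_le hS₂ (show 0 < |A₀| * |κ₂| / (8 * γ) by positivity)
  refine ⟨min (A₀ ^ 2 * κ₁ ^ 2) (A₀ ^ 2 * κ₂ ^ 2) / (16 * (9 * A₀ ^ 2 + 4)), ?_, ?_⟩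
  · have : 0 < min (A₀ ^ 2 * κ₁ ^ 2) (A₀ ^ 2 * κ₂ ^ 2) := lt_min (by positivity) (by positivity)
    positivity
  filter_upwards [e1, e2, e3, e4, e5, e6, e7] with p h1 h2 h3 h4 h5 h6 h7
  rw [hP₁, hP₂]
  have h4' : |a₁ p| ≤ γ := by
    have := abs_sub_abs_le_abs_sub (a₁ p) (a₁ p₀); have := abs_nonneg (a₂ p₀); linarith
  have h5' : |a₂ p| ≤ γ := by
    have := abs_sub_abs_le_abs_sub (a₂ p) (a₂ p₀); have := abs_nonneg (a₁ p₀); linarith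
  rw [h0S₁, sub_zero] at h6
  rw [h0S₂, sub_zero] at h7
  exact floorAlg_diag hγ (hb₂ p) h1 h2 h3 h4' h5' h6 h7

/-- **Registered sub-goal `floorLocal_triple` of stub B1b″: local floor near a triple point.** If
`a₁ + a₂ + a₃ ≠ 0` and `c₁, c₂ ≠ 0` at `p₀` (all five continuous there), then for some `c > 0`, eventually
`c·μ ≤ P₁² + P₃² + P₂²`. [folklore] -/
theorem floorLocal_triple :
    ∀ {V : Type*} [TopologicalSpace V] (A S₁ S₂ a₁ a₂ a₃ c₁ c₂ P₁ P₂ P₃ : V → ℝ) (p₀ : V),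
      ContinuousAt a₁ p₀ → ContinuousAt a₂ p₀ → ContinuousAt a₃ p₀ → ContinuousAt c₁ p₀ → ContinuousAt c₂ p₀ →
      (∀ p, P₁ p = -(a₁ p * S₁ p * S₂ p) + A p * c₁ p * S₂ p) →
      (∀ p, P₂ p = -(a₂ p * S₁ p * S₂ p) + A p * S₁ p * c₂ p) →
      (∀ p, P₃ p = -(a₃ p * S₁ p * S₂ p) - A p * c₁ p * S₂ p - A p * S₁ p * c₂ p) →
      a₁ p₀ + a₂ p₀ + a₃ p₀ ≠ 0 → c₁ p₀ ≠ 0 → c₂ p₀ ≠ 0 →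
      ∃ c : ℝ, 0 < c ∧ ∀ᶠ p in 𝓝 p₀,
        c * (A p ^ 2 * S₁ p ^ 2 + A p ^ 2 * S₂ p ^ 2 + S₁ p ^ 2 * S₂ p ^ 2) ≤
          P₁ p ^ 2 + P₃ p ^ 2 + P₂ p ^ 2 := by
  intro V _ A S₁ S₂ a₁ a₂ a₃ c₁ c₂ P₁ P₂ P₃ p₀ ha₁ ha₂ ha₃ hc₁ hc₂ hP₁ hP₂ hP₃ hβ hκ₁ hκ₂
  set β := a₁ p₀ + a₂ p₀ + a₃ p₀ with hβdef
  set κ₁ := c₁ p₀ with hκ₁def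
  set κ₂ := c₂ p₀ with hκ₂def
  set γ := |a₁ p₀| + |a₂ p₀| + 1 with hγdef
  have hγ : 1 ≤ γ := by have := abs_nonneg (a₁ p₀); have := abs_nonneg (a₂ p₀); linarith
  have hβp : 0 < |β| := abs_pos.2 hβ
  have hκ₁p : 0 < |κ₁| := abs_pos.2 hκ₁
  have hκ₂p : 0 < |κ₂| := abs_pos.2 hκ₂
  have hsum : ContinuousAt (fun p => a₁ p + a₂ p + a₃ p) p₀ := (ha₁.add ha₂).add ha₃
  have e1 := eventually_abs_sub_le hc₁ (half_pos hκ₁p)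
  have e2 := eventually_abs_sub_le hc₂ (half_pos hκ₂p)
  have e3 := eventually_abs_sub_le ha₁ one_pos
  have e4 := eventually_abs_sub_le ha₂ one_pos
  have e5 := eventually_abs_sub_le hsum (half_pos hβp)
  set L := 16 / κ₁ ^ 2 + 16 / κ₂ ^ 2 +
      3 * (64 * γ ^ 2 / (κ₁ ^ 2 * β ^ 2) + 64 * γ ^ 2 / (κ₂ ^ 2 * β ^ 2) + 4 / β ^ 2) with hLdef
  have hL : 0 < L := by positivity
  refine ⟨1 / L, by positivity, ?_⟩
  filter_upwards [e1, e2, e3, e4, e5] with p h1 h2 h3 h4 h5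
  have h3' : |a₁ p| ≤ γ := by
    have := abs_sub_abs_le_abs_sub (a₁ p) (a₁ p₀); have := abs_nonneg (a₂ p₀); linarith
  have h4' : |a₂ p| ≤ γ := by
    have := abs_sub_abs_le_abs_sub (a₂ p) (a₂ p₀); have := abs_nonneg (a₁ p₀); linarith
  have key := floorAlg_triple (A p) (S₁ p) (S₂ p) (a₁ p) (a₂ p) (a₃ p) (c₁ p) (c₂ p) β κ₁ κ₂ γ hγ
    h1 h2 h3' h4' h5 hβ hκ₁ hκ₂
  rw [hP₁, hP₂, hP₃, one_div, inv_mul_le_iff₀ hL]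
  exact key

/-- **Local floor at a regular point.** If `D` is continuous at `p₀` with `D(p₀) > 0` and `μ ≤ M`, then
`c·μ ≤ D` eventually for some `c > 0`. [folklore] -/
theorem floorLocal_regular {V : Type*} [TopologicalSpace V] {D μf : V → ℝ} {p₀ : V} {M : ℝ}
    (hD : ContinuousAt D p₀) (hpos : 0 < D p₀) (hM : 0 < M) (hμ : ∀ p, μf p ≤ M) :
    ∃ c : ℝ, 0 < c ∧ ∀ᶠ p in 𝓝 p₀, c * μf p ≤ D p := by
  refine ⟨D p₀ / (2 * M), by positivity, ?_⟩
  filter_upwards [eventually_abs_sub_le hD (half_pos hpos)] with p hp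
  have h1 : D p₀ / 2 ≤ D p := by have := (abs_le.1 hp).1; linarith
  calc D p₀ / (2 * M) * μf p ≤ D p₀ / (2 * M) * M := mul_le_mul_of_nonneg_left (hμ p) (by positivity)
    _ = D p₀ / 2 := by field_simp
    _ ≤ D p := h1

end Summit.AtomisticToContinuum.FouriersLaw.Theorems.DrudeDissolution.KineticPolymerGasOnTheTimeAxis

end
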